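import Summits.NavierStokesRegularity.NavierStokesRegularity.Theorems.LerayQuarterDissipationFiniteDissipationLiouvilleErgodicHullPortrait
import Summits.NavierStokesRegularity.NavierStokesRegularity.Theorems.LerayQuarterDissipationFiniteDissipationLiouvilleEnergyFloor
import Summits.NavierStokesRegularity.NavierStokesRegularity.Theorems.LerayQuarterDissipationFiniteDissipationLiouvilleTraceMorrey
import HarnessLib

/-!
# Crux `FiniteDissipationLiouville` (stmt-NavierStokesRegularity-22144), line `birth`:
# TAME OBSERVABLES — the scaled core energy has a MEAN along the blow-up sequence of the
# quasi-regular critical element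

Helper file (theorems only, `--supports` the crux), companion of `…ErgodicHull` /
`…ErgodicHullPortrait` (lead g12). The quasi-regular critical element `W ∈ 𝒟_{C,K_c}` has
convergent Cesàro means `N⁻¹ Σ_{k<N} G(W_{λ^k})` for every observable `G` of fields which is
continuous along `𝒟_{C,K}` for uniform convergence on the slab pieces ("tame"). This file shows
that the line's own portrait quantities are tame and draws the concrete conclusion:

* `tendsto_sliceBallEnergy` — the SLICE-BALL ENERGY `w ↦ ∫_{B(0,r)} ‖w(−1,x)‖² dx` is tame on
  the Type-I class with constant `C` (pointwise convergence at `t = −1` from uniform convergence on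
  the pieces + the class-uniform bound `‖w(−1,x)‖ ≤ C`, dominated convergence on the ball);
* `sliceBallEnergy_nsRescale` — along the scaling orbit it IS the scaled core energy:
  `∫_{B(0,r)} ‖w_c(−1)‖² = c⁻¹ ∫_{B(0,cr)} ‖w(−c²)‖² = (−t)^{−1/2} ∫_{B(0,r√(−t))} ‖w(t)‖²` at
  `t = −c²` (lead g9's `EnergyFloor.setLIntegral_ball_nsRescale_sq`);
* `exists_meanCoreEnergy_of_quasiRegular` — hence for a member quasi-regular for the step `½`
  (the BLOW-UP direction) and every similarity radius `r > 0` the scaled core energies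
  `e_r(t_k) := (−t_k)^{−1/2} ∫_{B(0, r√(−t_k))} ‖W(t_k)‖²` along the blow-up sequence
  `t_k = −4^{−k}` have a CESÀRO MEAN `ℓ_r = lim N⁻¹ Σ_{k<N} e_r(t_k)`; by lead g9's two-sided core
  energy law (`δ(C,K,r)√(−t) < ∫_{B(0,r√(−t))}‖W(t)‖²` at every instant of a singular member) the
  mean satisfies `ℓ_r ≥ δ` when `W` is singular (`meanCoreEnergy_floor`).

So the v25 clause of the skeleton reads, concretely: a finite-dissipation Type-I singularity may
be assumed to have WELL-DEFINED MEAN SCALING STATISTICS along its blow-up sequence — e.g. a mean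
core energy in `[δ, ∞)` for every similarity radius — in addition to every-instant floors and
ceilings. PORTRAIT; no scenario is excluded; verdict FRONTIER unchanged. No summit is proved by
this file; Navier–Stokes regularity is NOT proved by anything here.

References: J. C. Oxtoby, Bull. AMS 58 (1952) §2 [Oxtoby1952]; G. Koch, N. Nadirashvili,
G. Seregin, V. Šverák, Acta Math. 203 (2009) §4 [KochNadirashviliSereginSverak2009].
-/

noncomputable section

-- the summit and its single problem share the name (D-0017 nested layout)
set_option linter.dupNamespace false

namespace Summit.NavierStokesRegularity.NavierStokesRegularity.Theorems.FiniteDissipationLiouville.ErgodicHull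

open scoped Topology ENNReal
open MeasureTheory Set Function Filter Metric TopologicalSpace Topology
open Literature.Analysis.FluidPDE

/-! ### §1 The slice-ball energy is a tame observable -/

/-- The slice `x ↦ w(t,x)` of a Type-I ancient mild field is continuous for `t < 0`. [folklore] -/
theorem continuous_slice {C : ℝ} {w : ℝ → EuclideanSpace ℝ (Fin 3) → EuclideanSpace ℝ (Fin 3)}
    (hw : IsTypeIAncientMild C w) {t : ℝ} (ht : t < 0) : Continuous fun x => w t x :=
  hw.continuousOn_uncurry.comp_continuous (f := fun x => ((t, x) : ℝ × EuclideanSpace ℝ (Fin 3)))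
    (by fun_prop) fun x => ⟨ht, mem_univ _⟩

/-- The slice-ball energy of a Type-I ancient mild field at `t = −1` is finite:
`∫_{B(0,r)} ‖w(−1)‖² ≤ C² |B(0,r)| < ∞`. [folklore] -/
theorem sliceBallEnergy_lt_top {C : ℝ} {w : ℝ → EuclideanSpace ℝ (Fin 3) → EuclideanSpace ℝ (Fin 3)}
    (hw : IsTypeIAncientMild C w) (r : ℝ) :
    ∫⁻ x in ball (0 : EuclideanSpace ℝ (Fin 3)) r, ‖w (-1) x‖ₑ ^ 2 < ∞ := by
  have hb : ∀ x, ‖w (-1) x‖ₑ ^ 2 ≤ ENNReal.ofReal (C ^ 2) := by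
    intro x
    have h1 : ‖w (-1) x‖ ≤ C := by
      have h := hw.norm_le (show (-1 : ℝ) < 0 by norm_num) x
      rwa [neg_neg, Real.sqrt_one, div_one] at h
    rw [← ofReal_norm, ← ENNReal.ofReal_pow (norm_nonneg _)]
    exact ENNReal.ofReal_le_ofReal (pow_le_pow_left₀ (norm_nonneg _) h1 2)
  calc ∫⁻ x in ball (0 : EuclideanSpace ℝ (Fin 3)) r, ‖w (-1) x‖ₑ ^ 2
      ≤ ∫⁻ _x in ball (0 : EuclideanSpace ℝ (Fin 3)) r, ENNReal.ofReal (C ^ 2) := lintegral_mono fun x => hb x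
    _ = ENNReal.ofReal (C ^ 2) * volume (ball (0 : EuclideanSpace ℝ (Fin 3)) r) := by
        rw [lintegral_const, Measure.restrict_apply MeasurableSet.univ, univ_inter]
    _ < ∞ := ENNReal.mul_lt_top ENNReal.ofReal_lt_top measure_ball_lt_top

/-- **The slice-ball energy `w ↦ ∫_{B(0,r)} ‖w(−1,x)‖² dx` is a TAME observable** on the Type-I
class with constant `C`: if members `v_j` converge to a member `w` uniformly on every slab piece
`[−(n+2), −1/(n+2)] × B̄(0, n+2)`, the slice-ball energies converge (pointwise convergence at
`t = −1`, the class-uniform bound `‖v_j(−1,x)‖ ≤ C`, dominated convergence on the ball). [folklore] -/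
theorem tendsto_sliceBallEnergy {C : ℝ} (r : ℝ)
    {v : ℕ → ℝ → EuclideanSpace ℝ (Fin 3) → EuclideanSpace ℝ (Fin 3)}
    {w : ℝ → EuclideanSpace ℝ (Fin 3) → EuclideanSpace ℝ (Fin 3)}
    (hv : ∀ j, IsTypeIAncientMild C (v j)) (hw : IsTypeIAncientMild C w)
    (h : ∀ n : ℕ, TendstoUniformlyOn (fun j z => v j z.1 z.2) (fun z => w z.1 z.2) atTop
      (Icc (-((n : ℝ) + 2)) (-(1 / ((n : ℝ) + 2))) ×ˢ
        closedBall (0 : EuclideanSpace ℝ (Fin 3)) ((n : ℝ) + 2))) :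
    Tendsto (fun j => (∫⁻ x in ball (0 : EuclideanSpace ℝ (Fin 3)) r, ‖v j (-1) x‖ₑ ^ 2).toReal)
      atTop (𝓝 ((∫⁻ x in ball (0 : EuclideanSpace ℝ (Fin 3)) r, ‖w (-1) x‖ₑ ^ 2).toReal)) := by
  have h1 : (-1 : ℝ) < 0 := by norm_num
  have hlim : Tendsto (fun j => ∫⁻ x in ball (0 : EuclideanSpace ℝ (Fin 3)) r, ‖v j (-1) x‖ₑ ^ 2)
      atTop (𝓝 (∫⁻ x in ball (0 : EuclideanSpace ℝ (Fin 3)) r, ‖w (-1) x‖ₑ ^ 2)) := by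
    refine tendsto_lintegral_of_dominated_convergence (fun _ => ENNReal.ofReal (C ^ 2))
      (fun j => ((continuous_slice (hv j) h1).measurable.enorm.pow_const 2)) (fun j => ?_) ?_ ?_
    · refine Eventually.of_forall fun x => ?_
      have hb : ‖v j (-1) x‖ ≤ C := by
        have h := (hv j).norm_le h1 x
        rwa [neg_neg, Real.sqrt_one, div_one] at h
      show ‖v j (-1) x‖ₑ ^ 2 ≤ ENNReal.ofReal (C ^ 2)
      rw [← ofReal_norm, ← ENNReal.ofReal_pow (norm_nonneg _)]
      exact ENNReal.ofReal_le_ofReal (pow_le_pow_left₀ (norm_nonneg _) hb 2)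
    · rw [lintegral_const, Measure.restrict_apply MeasurableSet.univ, univ_inter]
      exact (ENNReal.mul_lt_top ENNReal.ofReal_lt_top measure_ball_lt_top).ne
    · refine Eventually.of_forall fun x => ?_
      have hpt : Tendsto (fun j => v j (-1) x) atTop (𝓝 (w (-1) x)) :=
        tendsto_of_tendstoUniformlyOn_slabPiece (V := fun j z => v j z.1 z.2)
          (W := fun z => w z.1 z.2) h h1 x
      exact ((ENNReal.continuous_pow 2).tendsto _).comp hpt.enorm
  exact (ENNReal.tendsto_toReal (sliceBallEnergy_lt_top hw r).ne).comp hlim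

/-- **Along the scaling orbit the slice-ball energy is the scaled core energy**:
`∫_{B(0,r)} ‖w_c(−1)‖² = c⁻¹ ∫_{B(0, cr)} ‖w(−c²)‖²` (`c > 0`), i.e. `(−t)^{−1/2}∫_{B(0,r√(−t))}‖w(t)‖²`
at `t = −c²` (lead g9's `EnergyFloor.setLIntegral_ball_nsRescale_sq`). [folklore] -/
theorem sliceBallEnergy_nsRescale {c : ℝ} (hc : 0 < c)
    (w : ℝ → EuclideanSpace ℝ (Fin 3) → EuclideanSpace ℝ (Fin 3)) (r : ℝ) :
    (∫⁻ x in ball (0 : EuclideanSpace ℝ (Fin 3)) r, ‖nsRescale c w (-1) x‖ₑ ^ 2).toReal =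
      c⁻¹ * (∫⁻ y in ball (0 : EuclideanSpace ℝ (Fin 3)) (c * r), ‖w (-(c ^ 2)) y‖ₑ ^ 2).toReal := by
  rw [EnergyFloor.setLIntegral_ball_nsRescale_sq hc w (-1) r, ENNReal.toReal_mul,
    ENNReal.toReal_ofReal (inv_nonneg.2 hc.le), mul_neg_one]

/-! ### §2 The mean core energy along the blow-up sequence -/

/-- **The scaled core energy has a Cesàro mean along the blow-up sequence of a quasi-regular
member.** Let `W ∈ 𝒟_{C,K}` be quasi-regular for the step `½` (clause (b) of
`exists_quasiRegular` with `λ = ½`: every tame observable has convergent Cesàro means along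
`W_{2^{−k}}`). Then for every similarity radius `r > 0` the scaled core energies
`e_r(t_k) = (−t_k)^{−1/2} ∫_{B(0, r√(−t_k))} ‖W(t_k)‖²` along `t_k = −4^{−k}` have a mean:
`N⁻¹ Σ_{k<N} e_r(t_k) → ℓ_r`. [cite: Oxtoby1952, §2 (2.2) p. 118 (quasi-regular points)] -/
theorem exists_meanCoreEnergy_of_quasiRegular {C K : ℝ}
    {W : ℝ → EuclideanSpace ℝ (Fin 3) → EuclideanSpace ℝ (Fin 3)} (hW : IsTypeIAncientMild C W)
    (hq : ∀ G : (ℝ → EuclideanSpace ℝ (Fin 3) → EuclideanSpace ℝ (Fin 3)) → ℝ,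
      (∀ (v : ℕ → ℝ → EuclideanSpace ℝ (Fin 3) → EuclideanSpace ℝ (Fin 3))
          (w : ℝ → EuclideanSpace ℝ (Fin 3) → EuclideanSpace ℝ (Fin 3)),
        (∀ j, IsTypeIAncientMild C (v j)) →
        (∀ j, ∀ s : ℝ, s < 0 →
          ∫⁻ x, ‖fderiv ℝ (v j s) x‖ₑ ^ 2 ≤ ENNReal.ofReal (K / Real.sqrt (-s))) →
        IsTypeIAncientMild C w →
        (∀ s : ℝ, s < 0 → ∫⁻ x, ‖fderiv ℝ (w s) x‖ₑ ^ 2 ≤ ENNReal.ofReal (K / Real.sqrt (-s))) →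
        (∀ n : ℕ, TendstoUniformlyOn (fun j z => v j z.1 z.2) (fun z => w z.1 z.2) atTop
          (Icc (-((n : ℝ) + 2)) (-(1 / ((n : ℝ) + 2))) ×ˢ
            closedBall (0 : EuclideanSpace ℝ (Fin 3)) ((n : ℝ) + 2))) →
        Tendsto (fun j => G (v j)) atTop (𝓝 (G w))) →
      (∃ B : ℝ, ∀ c : ℝ, 0 < c → |G (nsRescale c W)| ≤ B) ∧
      ∃ ℓ : ℝ, Tendsto (fun N : ℕ => (N : ℝ)⁻¹ * ∑ k ∈ Finset.range N,
        G (nsRescale ((1 / 2 : ℝ) ^ k) W)) atTop (𝓝 ℓ))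
    (r : ℝ) :
    ∃ ℓ : ℝ, Tendsto (fun N : ℕ => (N : ℝ)⁻¹ * ∑ k ∈ Finset.range N,
      (((1 / 2 : ℝ) ^ k)⁻¹ * (∫⁻ y in ball (0 : EuclideanSpace ℝ (Fin 3)) ((1 / 2 : ℝ) ^ k * r),
        ‖W (-(((1 / 2 : ℝ) ^ k) ^ 2)) y‖ₑ ^ 2).toReal)) atTop (𝓝 ℓ) := by
  have _ := hW
  obtain ⟨-, ℓ, hℓ⟩ := hq (fun w => (∫⁻ x in ball (0 : EuclideanSpace ℝ (Fin 3)) r, ‖w (-1) x‖ₑ ^ 2).toReal)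
    (fun v w hv _ hw _ h => tendsto_sliceBallEnergy r hv hw h)
  refine ⟨ℓ, hℓ.congr fun N => ?_⟩
  congr 1
  refine Finset.sum_congr rfl fun k _ => ?_
  exact sliceBallEnergy_nsRescale (pow_pos (by norm_num) k) W r

/-- **The mean core energy of a singular member is at least the floor `δ(C,K,r)`.** If moreover
`W` is SINGULAR at the apex, lead g9's every-instant floor
`δ √(−t) < ∫_{B(0, r√(−t))} ‖W(t)‖²` (`EnergyFloor.coreEnergy_floor_of_singular`) makes every term
of the Cesàro means `> δ`, so the mean `ℓ_r` of `exists_meanCoreEnergy_of_quasiRegular` satisfies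
`δ ≤ ℓ_r`: a singular quasi-regular member has a NONTRIVIAL mean core energy at every similarity
radius. [cite: KochNadirashviliSereginSverak2009, Prop. 4.1 (arXiv:0709.3599 p. 8)] -/
theorem meanCoreEnergy_floor {C K r δ ℓ : ℝ} (hr : 0 < r)
    {W : ℝ → EuclideanSpace ℝ (Fin 3) → EuclideanSpace ℝ (Fin 3)} (hW : IsTypeIAncientMild C W)
    (hDW : ∀ s : ℝ, s < 0 → ∫⁻ x, ‖fderiv ℝ (W s) x‖ₑ ^ 2 ≤ ENNReal.ofReal (K / Real.sqrt (-s)))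
    (hfloor : ∀ t < 0, ENNReal.ofReal (δ * Real.sqrt (-t)) <
      ∫⁻ x in ball (0 : EuclideanSpace ℝ (Fin 3)) (r * Real.sqrt (-t)), ‖W t x‖ₑ ^ 2)
    (hℓ : Tendsto (fun N : ℕ => (N : ℝ)⁻¹ * ∑ k ∈ Finset.range N,
      (((1 / 2 : ℝ) ^ k)⁻¹ * (∫⁻ y in ball (0 : EuclideanSpace ℝ (Fin 3)) ((1 / 2 : ℝ) ^ k * r),
        ‖W (-(((1 / 2 : ℝ) ^ k) ^ 2)) y‖ₑ ^ 2).toReal)) atTop (𝓝 ℓ)) :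
    δ ≤ ℓ := by
  -- the ceiling of the stratum makes every core energy finite
  obtain ⟨Λ, hΛ⟩ := Birth.Apex.lintegral_ball_sq_le_unif K
  -- every term of the means exceeds `δ`
  have hterm : ∀ k : ℕ, δ ≤ ((1 / 2 : ℝ) ^ k)⁻¹ *
      (∫⁻ y in ball (0 : EuclideanSpace ℝ (Fin 3)) ((1 / 2 : ℝ) ^ k * r),
        ‖W (-(((1 / 2 : ℝ) ^ k) ^ 2)) y‖ₑ ^ 2).toReal := by
    intro k
    set c : ℝ := (1 / 2 : ℝ) ^ k with hc
    have hc0 : 0 < c := pow_pos (by norm_num) k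
    have ht : -(c ^ 2) < 0 := neg_neg_of_pos (pow_pos hc0 2)
    have hsq : Real.sqrt (-(-(c ^ 2))) = c := by rw [neg_neg, Real.sqrt_sq hc0.le]
    -- finiteness from the ceiling on the larger ball `B(0, (r+1)c)` at time `−c²`
    have hfin : ∫⁻ y in ball (0 : EuclideanSpace ℝ (Fin 3)) (c * r), ‖W (-(c ^ 2)) y‖ₑ ^ 2 ≠ ∞ := by
      have hρ : 0 < (r + 1) * c := mul_pos (by linarith) hc0
      have hmem : -(c ^ 2) ∈ Ioo (-((r + 1) * c) ^ 2) 0 := by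
        refine ⟨?_, ht⟩
        have : c ^ 2 < ((r + 1) * c) ^ 2 := by
          rw [mul_pow]
          nlinarith [mul_pos hr (pow_pos hc0 2), mul_pos (mul_pos hr hr) (pow_pos hc0 2)]
        linarith
      have h1 := hΛ C W hW hDW 0 ((r + 1) * c) hρ (-(c ^ 2)) hmem
      refine ne_top_of_le_ne_top (ENNReal.mul_lt_top ENNReal.ofReal_lt_top ENNReal.coe_lt_top).ne
        ((lintegral_mono_set (ball_subset_ball (by nlinarith))).trans h1)
    have hfl := hfloor (-(c ^ 2)) ht
    rw [hsq, mul_comm r c] at hfl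
    have h2 : δ * c ≤ (∫⁻ y in ball (0 : EuclideanSpace ℝ (Fin 3)) (c * r), ‖W (-(c ^ 2)) y‖ₑ ^ 2).toReal := by
      have := (ENNReal.ofReal_le_iff_le_toReal hfin).1 hfl.le
      exact this
    calc δ = c⁻¹ * (δ * c) := by field_simp
      _ ≤ c⁻¹ * (∫⁻ y in ball (0 : EuclideanSpace ℝ (Fin 3)) (c * r), ‖W (-(c ^ 2)) y‖ₑ ^ 2).toReal :=
          mul_le_mul_of_nonneg_left h2 (inv_nonneg.2 hc0.le)
  -- means of terms `≥ δ` are `≥ δ` from `N = 1` on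
  refine ge_of_tendsto hℓ ?_
  filter_upwards [eventually_ge_atTop 1] with N hN
  have hN' : (0 : ℝ) < N := by exact_mod_cast hN
  calc δ = (N : ℝ)⁻¹ * ∑ _k ∈ Finset.range N, δ := by
        rw [Finset.sum_const, Finset.card_range, nsmul_eq_mul]; field_simp
    _ ≤ _ := mul_le_mul_of_nonneg_left (Finset.sum_le_sum fun k _ => hterm k) (inv_nonneg.2 hN'.le)

end Summit.NavierStokesRegularity.NavierStokesRegularity.Theorems.FiniteDissipationLiouville.ErgodicHull

end
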